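import Summits.HodgeConjecture.HodgeConjecture.Theorems.F0P3SpectralPacketRigidityReductionH   -- ★ LH7-p03 p848117: `SpectralPacketH.xiRigidityH_of_fibre` (+ ★ p848041 Satake, ★ 3t `XiRigidityH`, ★ 3r `rhoXiS`, `memH_rhoXiS_loc`)
import HarnessLib

/-!
# (PK-A-H) RIGIDITY FROM TWO PRINT ROWS — (L3) `XiRigidityH` from (KD1), (KD3), the LOCAL A-FIBRE row (KR-1) and the GLOBAL H-SIDE row (KR-2), kit-generic
# (the closer of the proposed organ O5 `PKrigidHOfKRLetter` of the LH7 leaf; Rogawski §13.1 p. 199 ¶2, Prop. 13.1.3 (d); §13.3 Thms. 13.3.2∕13.3.4∕13.3.5, p. 202; §13.7 p. 206)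

Cell `hodgecm-mathlib`, F0∕P3c line LH7 (leaf `Cruxes/H413/Lines/F0_P3c_PKtuplePaydown.lean` ED. 1 8127ee3e, organs O1∕O2 open), crux H413 = `stmt-HodgeConjecture-24833`; organ payer
LH7-p03 (g0), DEAL (p3) of LH7-plan (g0) 03:46:17Z, memo `F0/P3c/LH7/LH7-p03/g0/MEMO-RIGID-H-SLICE.v1.md` 5409414b3abfc9f3 (VERDICT R = {KR-1, KR-2}).  `--supports stmt-HodgeConjecture-24833`;
closes no stub; touches neither `𝔩.pair` nor the `ε` slot.

THE MATHEMATICS.  ★ p848117 `xiRigidityH_of_fibre` needs, beyond the kit laws (KD3), (KG1), (KG3′), the guard, binder 33 and the ★ record facts, TWO inputs: the A-fibre `hfibH` and the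
global `hglobH`.  In the MEMBER-SET currency of (KD1) («`memH ρ = memH ρ′ ⇒ ρ = ρ′`», T-A row 19) and of ★ `IsCharPacket` (`memH (ρ(ξ)_v) = {⟦ℂ_{χ ξ v}⟧}`, ★ `memH_rhoXiS_loc`) they follow from
two statements that do not mention the shape witness `hXiHS` — so they can be ORGAN ROWS:
* (KR-1) LOCAL A-FIBRE: «an `H_v`-packet whose `ξ_H`-image contains `πⁿ(ξ_v)` has member set `{⟦ℂ_{ξ_v}⟧}`» [p. 199 ¶2: `πⁿ(ξ_v)` lies only in `Π(ξ_v) = ξ_H(ξ_v)`; Prop. 13.1.3 (d);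
  §12.2: `πⁿ(ξ_v)` determines `ξ_v`] ⇒ `hfibH` by (KD1);
* (KR-2) GLOBAL: «a `DiscH`-discrete `H`-packet whose member sets are `{⟦ℂ_{ξ_v}⟧}` at almost every place has them at every place» [strong multiplicity one on `H = U(2) × U(1)`
  against characters: Thm. 13.3.2, Thm. 13.3.4, Thm. 13.3.5 and «`Π_a(𝐆)`, `Π_e(𝐆)` disjoint» p. 202] ⇒ `hglobH` by (KD1).
Satake at the good places is in-house (★ p848041).

CONTENTS (namespace ★ 3g∕3r∕3t `…F0P3SpectralPacket.SpectralPacketH`): `fibreH_of_KR1`, `globH_of_KR2`, **`xiRigidityH_of_KR`** ((L3) from (KD1)+(KD3)+(KR-1)+(KR-2)+(KG1)+(KG3′)+guard+vol+record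
shapes).  No instance, no notation, no named fact, no `sorry`.
HONEST LABEL: HC_CM is proved only modulo the 7 printed citations (2 remaining: hLiu418 = stmt-HodgeConjecture-24832, h413 = stmt-HodgeConjecture-24833) until rung 0 closes;
this file proves no printed statement — it reduces the rigidity conjunct of (PK-A-H) to two named print rows and the kit laws.

References: [Rogawski1990] §13.1 p. 199 ¶2, Prop. 13.1.3 (d) p. 199; §12.2 pp. 173–174; §13.3 Thms. 13.3.2, 13.3.4, 13.3.5 p. 202, p. 202 l. 16–18, p. 203; §13.7 p. 206; §11.1 p. 158.
[CartierCorvallis1979] §IV.1 Cor. 4.1.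
-/

set_option autoImplicit false
-- the mandated namespace repeats `HodgeConjecture.HodgeConjecture`, as in every `Theorems/*.lean` of this sub-problem
set_option linter.dupNamespace false

noncomputable section

open NumberField IsDedekindDomain MeasureTheory
open scoped Matrix MatrixGroups

open Literature.NumberTheory Literature.NumberTheory.Automorphic Literature.NumberTheory.Automorphic.UnitaryGroup
open Literature.NumberTheory.Rogawski1990 Literature.NumberTheory.GaloisRepresentations
open Literature.RepresentationTheory.BorelWallach2000 Literature.RepresentationTheory.KonnoKonno2007
open Summit.HodgeConjecture.HodgeConjecture.Cruxes.H413.F0P3InnerFormClassificationV6 (splitForm EvpData EqOff)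
open Summit.HodgeConjecture.HodgeConjecture.Cruxes.H413.F0P3LocalPacketKit
open Summit.HodgeConjecture.HodgeConjecture.Cruxes.H413.F0P3ArchPacketKit

namespace Summit.HodgeConjecture.HodgeConjecture.Cruxes.H413.F0P3SpectralPacket.SpectralPacketH

open Summit.HodgeConjecture.HodgeConjecture.Cruxes.H413.F0P3GlobalPacket

/-! ## §1 The two derivations in the member-set currency [§11.1 p. 158; §12.1 p. 171; p. 199 ¶2] -/

section MemberSets

variable {L : Type} [Field L] [NumberField L] [IsCMField L] {H' : Matrix (Fin 3) (Fin 3) L}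
  {𝔩 : ∀ v : HeightOneSpectrum (𝓞 ↥(maximalRealSubfield L)), LocalPacketKit L H' v} {𝔞 : ArchPacketKit} {𝔞H : ArchPacketKitH 𝔞}
  {DiscH : GlobalPacketH 𝔩 → 𝔞H.PktInfH → Prop}
  {PkX : OneDimAutRepH L → ∀ v : HeightOneSpectrum (𝓞 ↥(maximalRealSubfield L)), CMLocalAPacket L H' v}
  {PkInfX : OneDimAutRepH L → LocalAPacket (GKIrrClass (uFormGroup (Fin 2) (Fin 1)))}
  {χ : OneDimAutRepH L → ∀ v : HeightOneSpectrum (𝓞 ↥(maximalRealSubfield L)),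
    (UnitaryGroup.cmDatum L 2 (Matrix.of fun i j : Fin 2 => if i.val + j.val + 1 = 2 then (1 : L) else 0)).Local v ×
      (UnitaryGroup.cmDatum L 1 (Matrix.of fun i j : Fin 1 => if i.val + j.val + 1 = 1 then (1 : L) else 0)).Local v →* ℂˣ}
  {hχ : ∀ (ξ : OneDimAutRepH L) (v : HeightOneSpectrum (𝓞 ↥(maximalRealSubfield L))),
    IsOpen (((χ ξ v).ker : Subgroup ((UnitaryGroup.cmDatum L 2 (Matrix.of fun i j : Fin 2 => if i.val + j.val + 1 = 2 then (1 : L) else 0)).Local v ×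
      (UnitaryGroup.cmDatum L 1 (Matrix.of fun i j : Fin 1 => if i.val + j.val + 1 = 1 then (1 : L) else 0)).Local v)) :
      Set ((UnitaryGroup.cmDatum L 2 (Matrix.of fun i j : Fin 2 => if i.val + j.val + 1 = 2 then (1 : L) else 0)).Local v ×
        (UnitaryGroup.cmDatum L 1 (Matrix.of fun i j : Fin 1 => if i.val + j.val + 1 = 1 then (1 : L) else 0)).Local v))}
  {εX : OneDimAutRepH L → HeightOneSpectrum (𝓞 ↥(maximalRealSubfield L)) → ℤ} {κHX : OneDimAutRepH L → ℤ}

/-- **`hfibH` FROM (KR-1) + (KD1)**: if every `H_v`-packet whose image contains `πⁿ(ξ_v)` has member set `{⟦ℂ_{χ ξ v}⟧}` (KR-1) and `H_v`-packets are their member sets (KD1), then such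
a packet IS `(rhoXiS hH ξ)_v` (whose member set is `{⟦ℂ_{χ ξ v}⟧}`, ★ `memH_rhoXiS_loc`). [cite: Rogawski1990, §13.1 p. 199 ¶2, Prop. 13.1.3 (d) p. 199; §11.1 p. 158; §12.1 p. 171] -/
theorem fibreH_of_KR1 (hH : XiHPacketsSigned 𝔩 𝔞 𝔞H DiscH PkX PkInfX χ hχ εX κHX)
    (hKD1 : ∀ (v : HeightOneSpectrum (𝓞 ↥(maximalRealSubfield L))) (ρ ρ' : (𝔩 v).PktH), (𝔩 v).memH ρ = (𝔩 v).memH ρ' → ρ = ρ')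
    (hKR1 : ∀ (ξ : OneDimAutRepH L) (v : HeightOneSpectrum (𝓞 ↥(maximalRealSubfield L))) (r : (𝔩 v).PktH),
      (PkX ξ v).πn ∈ (𝔩 v).mem ((𝔩 v).xiH r) → (𝔩 v).memH r = {IrrClass.mk (SmoothIrrep.ofChar (χ ξ v) (hχ ξ v))})
    (ξ : OneDimAutRepH L) (v : HeightOneSpectrum (𝓞 ↥(maximalRealSubfield L))) (r : (𝔩 v).PktH) (hmem : (PkX ξ v).πn ∈ (𝔩 v).mem ((𝔩 v).xiH r)) :
    r = (rhoXiS hH ξ).fin.loc v :=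
  hKD1 v _ _ ((hKR1 ξ v r hmem).trans (memH_rhoXiS_loc hH ξ v).symm)

/-- **`hglobH` FROM (KR-2) + (KD1)**: if a discrete `H`-packet with member sets `{⟦ℂ_{χ ξ v}⟧}` at almost every place has them everywhere (KR-2), then a discrete `ρ` equal to `ρ(ξ)` off a
finite set `T` equals `ρ(ξ)` everywhere. [cite: Rogawski1990, §13.3 Thm. 13.3.2, Thm. 13.3.4, Thm. 13.3.5 p. 202, p. 202 l. 16–18, p. 203; §11.1 p. 158] -/
theorem globH_of_KR2 (hH : XiHPacketsSigned 𝔩 𝔞 𝔞H DiscH PkX PkInfX χ hχ εX κHX)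
    (hKD1 : ∀ (v : HeightOneSpectrum (𝓞 ↥(maximalRealSubfield L))) (ρ ρ' : (𝔩 v).PktH), (𝔩 v).memH ρ = (𝔩 v).memH ρ' → ρ = ρ')
    (hKR2 : ∀ (ρ : SpectralPacketH 𝔩 𝔞 𝔞H DiscH) (ξ : OneDimAutRepH L) (T : Finset (HeightOneSpectrum (𝓞 ↥(maximalRealSubfield L)))),
      (∀ v ∉ T, (𝔩 v).memH (ρ.fin.loc v) = {IrrClass.mk (SmoothIrrep.ofChar (χ ξ v) (hχ ξ v))}) →
      ∀ v, (𝔩 v).memH (ρ.fin.loc v) = {IrrClass.mk (SmoothIrrep.ofChar (χ ξ v) (hχ ξ v))})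
    (ξ : OneDimAutRepH L) (ρ : SpectralPacketH 𝔩 𝔞 𝔞H DiscH) (T : Finset (HeightOneSpectrum (𝓞 ↥(maximalRealSubfield L))))
    (hoff : ∀ v ∉ T, ρ.fin.loc v = (rhoXiS hH ξ).fin.loc v) :
    ∀ v, ρ.fin.loc v = (rhoXiS hH ξ).fin.loc v := by
  have hall := hKR2 ρ ξ T fun v hv => by rw [hoff v hv, memH_rhoXiS_loc]
  exact fun v => hKD1 v _ _ ((hall v).trans (memH_rhoXiS_loc hH ξ v).symm)

end MemberSets

/-! ## §2 (L3) from the two print rows and the kit laws [Thm. 13.3.5 for `H`] -/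

section Rigidity

variable {L : Type} [Field L] [NumberField L] [IsCMField L] {H : Matrix (Fin 3) (Fin 3) L}
  {𝔩 : ∀ v : HeightOneSpectrum (𝓞 ↥(maximalRealSubfield L)), LocalPacketKit L (splitForm L 3) v} {𝔞 : ArchPacketKit} {𝔞H : ArchPacketKitH 𝔞}
  {DiscH : GlobalPacketH 𝔩 → 𝔞H.PktInfH → Prop}
  [∀ v : HeightOneSpectrum (𝓞 ↥(maximalRealSubfield L)), MeasurableSpace ((cmDatum L 3 (splitForm L 3)).Local v)]
  [∀ v : HeightOneSpectrum (𝓞 ↥(maximalRealSubfield L)), BorelSpace ((cmDatum L 3 (splitForm L 3)).Local v)]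
  [∀ v : HeightOneSpectrum (𝓞 ↥(maximalRealSubfield L)), MeasurableSpace ((cmDatum L 3 H).Local v)]
  [∀ v : HeightOneSpectrum (𝓞 ↥(maximalRealSubfield L)), BorelSpace ((cmDatum L 3 H).Local v)]
  {νG' : ∀ v : HeightOneSpectrum (𝓞 ↥(maximalRealSubfield L)), Measure ((cmDatum L 3 H).Local v)}
  [∀ v, (νG' v).IsMulLeftInvariant] [∀ v, IsFiniteMeasureOnCompacts (νG' v)]
  {ψ : ∀ v : HeightOneSpectrum (𝓞 ↥(maximalRealSubfield L)), (cmDatum L 3 H).Local v ≃ₜ* (cmDatum L 3 (splitForm L 3)).Local v}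
  {Pk' : OneDimAutRepH L → ∀ v : HeightOneSpectrum (𝓞 ↥(maximalRealSubfield L)), CMLocalAPacket L H v}
  {ram : OneDimAutRepH L → Finset (HeightOneSpectrum (𝓞 ↥(maximalRealSubfield L)))}
  {PkInf : OneDimAutRepH L → LocalAPacket (GKIrrClass (uFormGroup (Fin 2) (Fin 1)))}
  {χ : OneDimAutRepH L → ∀ v : HeightOneSpectrum (𝓞 ↥(maximalRealSubfield L)),
    (UnitaryGroup.cmDatum L 2 (Matrix.of fun i j : Fin 2 => if i.val + j.val + 1 = 2 then (1 : L) else 0)).Local v ×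
      (UnitaryGroup.cmDatum L 1 (Matrix.of fun i j : Fin 1 => if i.val + j.val + 1 = 1 then (1 : L) else 0)).Local v →* ℂˣ}
  {hχ : ∀ (ξ : OneDimAutRepH L) (v : HeightOneSpectrum (𝓞 ↥(maximalRealSubfield L))),
    IsOpen (((χ ξ v).ker : Subgroup ((UnitaryGroup.cmDatum L 2 (Matrix.of fun i j : Fin 2 => if i.val + j.val + 1 = 2 then (1 : L) else 0)).Local v ×
      (UnitaryGroup.cmDatum L 1 (Matrix.of fun i j : Fin 1 => if i.val + j.val + 1 = 1 then (1 : L) else 0)).Local v)) :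
      Set ((UnitaryGroup.cmDatum L 2 (Matrix.of fun i j : Fin 2 => if i.val + j.val + 1 = 2 then (1 : L) else 0)).Local v ×
        (UnitaryGroup.cmDatum L 1 (Matrix.of fun i j : Fin 1 => if i.val + j.val + 1 = 1 then (1 : L) else 0)).Local v))}
  {ε : OneDimAutRepH L → HeightOneSpectrum (𝓞 ↥(maximalRealSubfield L)) → ℤ} {κH : OneDimAutRepH L → ℤ}

/-- **(L3) `XiRigidityH` FROM (KD1) + (KD3) + (KR-1) + (KR-2) AND THE KIT∕RECORD FACTS** — the kit-generic closer of the proposed organ O5 `PKrigidHOfKRLetter` of the LH7 leaf: the A-fibre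
from (KR-1)+(KD1) (`fibreH_of_KR1`), the global `H`-input from (KR-2)+(KD1) (`globH_of_KR2`), Satake at the good places in-house (★ p848041 through ★ p848117 `xiRigidityH_of_fibre`).
[cite: Rogawski1990, §13.3 Thm. 13.3.5 p. 202, Thms. 13.3.2∕13.3.4 p. 202, p. 203; §13.1 p. 199 ¶2; §13.7 p. 206] [cite: CartierCorvallis1979, §IV.1 Cor. 4.1] -/
theorem xiRigidityH_of_KR {hH : XiHPacketsSigned 𝔩 𝔞 𝔞H DiscH (transportAPackets ψ Pk') PkInf χ hχ ε κH}
    (hKD1 : ∀ (v : HeightOneSpectrum (𝓞 ↥(maximalRealSubfield L))) (ρ ρ' : (𝔩 v).PktH), (𝔩 v).memH ρ = (𝔩 v).memH ρ' → ρ = ρ')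
    (hKD3 : ∀ (σ : GlobalPacketH 𝔩) (P P' : 𝔞H.PktInfH), DiscH σ P → DiscH σ P' → P = P')
    (hKR1 : ∀ (ξ : OneDimAutRepH L) (v : HeightOneSpectrum (𝓞 ↥(maximalRealSubfield L))) (r : (𝔩 v).PktH),
      (transportAPackets ψ Pk' ξ v).πn ∈ (𝔩 v).mem ((𝔩 v).xiH r) → (𝔩 v).memH r = {IrrClass.mk (SmoothIrrep.ofChar (χ ξ v) (hχ ξ v))})
    (hKR2 : ∀ (ρ : SpectralPacketH 𝔩 𝔞 𝔞H DiscH) (ξ : OneDimAutRepH L) (T : Finset (HeightOneSpectrum (𝓞 ↥(maximalRealSubfield L)))),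
      (∀ v ∉ T, (𝔩 v).memH (ρ.fin.loc v) = {IrrClass.mk (SmoothIrrep.ofChar (χ ξ v) (hχ ξ v))}) →
      ∀ v, (𝔩 v).memH (ρ.fin.loc v) = {IrrClass.mk (SmoothIrrep.ofChar (χ ξ v) (hχ ξ v))})
    (h4 : ∀ v : HeightOneSpectrum (𝓞 ↥(maximalRealSubfield L)), (𝔩 v).UnramLaw)
    (hKG3 : ∀ (v : HeightOneSpectrum (𝓞 ↥(maximalRealSubfield L))) (P : (𝔩 v).Pkt), ∀ π ∈ (𝔩 v).mem P, π.IsAdmissible)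
    (S₀ : Finset (HeightOneSpectrum (𝓞 ↥(maximalRealSubfield L))))
    (hψK : ∀ v ∉ S₀, (cmLocalIntegralLevel L 3 H v).map (ψ v : (cmDatum L 3 H).Local v →* (cmDatum L 3 (splitForm L 3)).Local v) =
      cmLocalIntegralLevel L 3 (splitForm L 3) v)
    (hvol : ∀ v : HeightOneSpectrum (𝓞 ↥(maximalRealSubfield L)), (νG' v).real (cmLocalIntegralLevel L 3 H v : Set ((cmDatum L 3 H).Local v)) ≠ 0)
    (hsph : ∀ (ξ : OneDimAutRepH L), ∀ v ∉ ram ξ, (Pk' ξ v).πn.IsSpherical (cmLocalIntegralLevel L 3 H v))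
    (hadmn : ∀ (ξ : OneDimAutRepH L) (v : HeightOneSpectrum (𝓞 ↥(maximalRealSubfield L))), (Pk' ξ v).πn.IsAdmissible)
    {tXi : OneDimAutRepH L → EvpData L H}
    (ht : ∀ (ξ : OneDimAutRepH L), ∀ v ∉ ram ξ, tXi ξ v = (Pk' ξ v).πn.eigencharacter (cmLocalIntegralLevel L 3 H v) (νG' v)) :
    XiRigidityH hH ψ (fun w => (νG' w).map (ψ w)) tXi := by
  classical
  refine xiRigidityH_of_fibre hKD3 (fun ξ v r hmem => fibreH_of_KR1 hH hKD1 hKR1 ξ v r (by rwa [transportAPackets_πn] at hmem ⊢)) h4 hKG3 S₀ hψK hvol hsph hadmn ht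
    fun ξ S ρ _ _ hoff => ?_
  exact globH_of_KR2 hH hKD1 hKR2 ξ ρ (S ∪ S₀ ∪ ram ξ) fun v hv => by
    simp only [Finset.mem_union, not_or] at hv
    exact hoff v hv.1.1 hv.1.2 hv.2

end Rigidity

end Summit.HodgeConjecture.HodgeConjecture.Cruxes.H413.F0P3SpectralPacket.SpectralPacketH

end
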